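import Summits.Parity.GeneralizedHardyLittlewood.Theorems.GoldbachHeathBrownDispersionHeathBrownMorozUniformReduction
import Literature.NumberTheory.Sieve.HeathBrownMorozResidueClassesSieve
import Literature.NumberTheory.Sieve.HeathBrownCubicPrimesAllLargeC
import HarnessLib

/-!
# Crux idea `parent-differencing` (stmt-Parity-19915, ideator #2, g1) — first lemmas

Lever: prove EQUIDISTRIBUTION of Heath-Brown primes over the admissible classes `(a, b) mod d`
by differencing Heath-Brown's own decomposition for the class sub-box `E^γ` against the PARENT box
(all coprime pairs of the big box of side `dηX`, = `residueClassPrimeCount (d·X) η 1 a b`) scaled by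
`w(d)/d² = 1/#{admissible classes}`: every Type-I / Fundamental-Lemma / Lemma-3.9 main term of the
class is TERMWISE `w(d)/d²` times the parent's (`typeIMainTerm_class_eq`, from the tree's
`coprimeClassWeight_mul_zetaTwoCorrection`), so singular series, `κ`, `ℬ`, Lemma 3.5 and the
§§8–10 main-term matching never appear for classes; what is left are coset lattice-count ERRORS,
the class Type II `f`-part, monotone discards, and the tree's `d = 1` theorem as a black box.
-/

noncomputable section

open Filter Asymptotics Finset Topology

namespace Summit.Parity.GeneralizedHardyLittlewood.Cruxes.HeathBrownMorozUniform.ParentDifferencing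

open Literature.NumberTheory.Sieve (SieveSequence primesProdBelow)
open Literature.NumberTheory.Sieve.CubicSieve (prodA densA)
open Literature.NumberTheory.Sieve.CubicPrimes
open Summit.Parity.GeneralizedHardyLittlewood.Theorems.GoldbachHeathBrownDispersionHeathBrownMorozUniform

/-! ### (D) The dictionary: class main terms are `w(d)/d²` × the parent's, termwise -/

/-- Off `d` the class density is Heath-Brown's own: `Γ_d(q) = Γ_1(q)` for `(q, d) = 1`. -/
theorem typeIDensity_eq_of_coprime {d q : ℕ} (h : Nat.Coprime q d) :
    typeIDensity d q = typeIDensity 1 q := by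
  rw [typeIDensity_def, typeIDensity_def]
  refine Finset.prod_congr rfl fun p hp => ?_
  have hpq : p ∣ q := Nat.dvd_of_mem_primeFactors hp
  have hpp : p.Prime := Nat.prime_of_mem_primeFactors hp
  have hpd : ¬ p ∣ d := (Nat.Prime.coprime_iff_not_dvd hpp).1 (Nat.Coprime.coprime_dvd_left hpq h)
  rw [if_neg hpd, if_neg hpp.not_dvd_one]

/-- On `d` the class main term vanishes: `[𝒜^γ_q] = 0` when `(q, d) > 1` (no value of an admissible
class is divisible by a prime dividing `d`). -/
theorem typeIMainTerm_eq_zero_of_not_coprime {d q : ℕ} (hq : q ≠ 0) (h : ¬ Nat.Coprime q d)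
    (X η : ℝ) : typeIMainTerm X η d q = 0 := by
  rw [typeIMainTerm_def, typeIDensity_def]
  obtain ⟨p, hp, hpq, hpd⟩ := Nat.Prime.not_coprime_iff_dvd.1 h
  have hmem : p ∈ q.primeFactors := Nat.mem_primeFactors.2 ⟨hp, hpq, hq⟩
  rw [Finset.prod_eq_zero hmem (by rw [if_pos hpd]), mul_zero]

/-- `coprimeClassWeight d > 0`. -/
theorem coprimeClassWeight_pos (d : ℕ) : 0 < coprimeClassWeight d := by
  unfold coprimeClassWeight
  refine Finset.prod_pos fun p hp => ?_
  have hpp : p.Prime := Nat.prime_of_mem_primeFactors hp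
  have hν := cast_add_one_sub_cubeRootTwoCount_pos hpp
  positivity

/-- **The dictionary.** For `(q, d) = 1`, `d ≠ 0`:
`typeIMainTerm X η d q = (w(d)/d²) · (coprimeClassWeight d)⁻¹ · typeIMainTerm (dX) η 1 q` — the class
Type-I main term is `w(d)/d²` times the main term of the PARENT box (side `dηX`, all classes) restricted
to values coprime to `d` (density factor `∏_{p∣d}(1 − ν_p/(p+1)) = (coprimeClassWeight d)⁻¹`).
Pure algebra from the tree's `coprimeClassWeight_mul_zetaTwoCorrection`; no class counting needed. -/
theorem typeIMainTerm_class_eq {d q : ℕ} (hd : d ≠ 0) (h : Nat.Coprime q d) (X η : ℝ) :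
    typeIMainTerm X η d q =
      classWeight d / (d : ℝ) ^ 2 * ((coprimeClassWeight d)⁻¹ * typeIMainTerm ((d : ℝ) * X) η 1 q) := by
  have hw : coprimeClassWeight d ≠ 0 := (coprimeClassWeight_pos d).ne'
  have hd' : (d : ℝ) ≠ 0 := Nat.cast_ne_zero.2 hd
  rw [typeIMainTerm_def, typeIMainTerm_def, typeIDensity_eq_of_coprime h, zetaTwoCorrection_one,
    ← coprimeClassWeight_mul_zetaTwoCorrection]
  field_simp

/-- The sifting-range form of the same dictionary: once `z` exceeds the prime factors of `d`,
`E_z(d) = coprimeClassWeight d`, so `[𝒜^γ]·V_{𝒜^γ}(z) = (w(d)/d²)·[parent]·V(z)`. -/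
theorem classEnhancementBelow_eq_of_lt {z : ℝ} {d : ℕ} (hd : d ≠ 0)
    (hz : ∀ p : ℕ, p.Prime → p ∣ d → (p : ℝ) < z) :
    classEnhancementBelow z d = coprimeClassWeight d := by
  unfold classEnhancementBelow coprimeClassWeight
  have hset : (Nat.primesBelow ⌈z⌉₊).filter (· ∣ d) = d.primeFactors := by
    ext p
    simp only [Finset.mem_filter, Nat.mem_primesBelow, Nat.mem_primeFactors]
    constructor
    · rintro ⟨⟨-, hp⟩, hpd⟩
      exact ⟨hp, hpd, hd⟩
    · rintro ⟨hp, hpd, -⟩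
      exact ⟨⟨Nat.lt_ceil.2 (hz p hp hpd), hp⟩, hpd⟩
  rw [hset]
  exact Finset.prod_congr rfl fun p hp => inv_one_sub_densA_eq (Nat.prime_of_mem_primeFactors hp)

/-! ### (L1) The lever in miniature: sifted class count vs sifted PARENT count — no Mertens product,
no singular series; only the two Fundamental-Lemma errors and the two Type-I remainder sums survive. -/

/-- **FIRST LEMMA (PROVED): the sifted class count is `w(d)/d²` times the sifted PARENT count, up to
the two Fundamental-Lemma errors and the two Type-I remainder sums.**  From the tree's two-sided
uniform Fundamental Lemma applied to BOTH sequences; the main terms `[𝒜^γ]V_{𝒜^γ}(z)` and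
`(w/d²)[parent]V(z)` cancel EXACTLY (`typeIMainTerm_class_eq`, `classEnhancementBelow_eq_of_lt`) — no
Mertens product, no singular series is ever evaluated. -/
theorem sifted_class_vs_parent :
    ∃ C : ℝ, 0 < C ∧ ∀ (X η z D : ℝ) (d a b : ℕ), 0 ≤ X → 0 < d → 2 ≤ z → z ≤ D →
      (∀ p : ℕ, p.Prime → p ∣ d → (p : ℝ) < z) →
      |(seqClass X η d a b).sifted (classTop X η d a b) (primesProdBelow z) -
          classWeight d / (d : ℝ) ^ 2 *
            (seqClass ((d : ℝ) * X) η 1 a b).sifted (classTop ((d : ℝ) * X) η 1 a b)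
              (primesProdBelow z)| ≤
        classWeight d / (d : ℝ) ^ 2 * (typeIMainTerm ((d : ℝ) * X) η 1 1 * prodA z) *
            (2 * C * Real.exp (-(Real.log D / Real.log z))) +
          ∑ q ∈ (primesProdBelow z).divisors.filter (fun q : ℕ => (q : ℝ) ≤ D),
            |(residueClassDivCount X η d a b q : ℝ) - typeIMainTerm X η d q| +
          classWeight d / (d : ℝ) ^ 2 *
            ∑ q ∈ (primesProdBelow z).divisors.filter (fun q : ℕ => (q : ℝ) ≤ D),
              |(residueClassDivCount ((d : ℝ) * X) η 1 a b q : ℝ) -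
                  typeIMainTerm ((d : ℝ) * X) η 1 q| := by
  obtain ⟨C, hC, hFL⟩ := SieveSequence.fundamental_lemma_uniform_holds 3
    Literature.NumberTheory.Sieve.CubicSieve.dimConst
  refine ⟨C, hC, fun X η z D d a b hX hd hz hzD hpz => ?_⟩
  have hcls := hFL (seqClass X η d a b) (hasSieveDimension_classDensity d) (classTop X η d a b) z D hz
    hzD (typeIMainTerm_one_nonneg X η d)
  have hpar := hFL (seqClass ((d : ℝ) * X) η 1 a b) (hasSieveDimension_classDensity 1)
    (classTop ((d : ℝ) * X) η 1 a b) z D hz hzD (typeIMainTerm_one_nonneg _ η 1)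
  -- remainders are the Type-I errors
  have hq0 : ∀ q ∈ (primesProdBelow z).divisors.filter (fun q : ℕ => (q : ℝ) ≤ D), q ≠ 0 :=
    fun q hq => (Nat.pos_of_mem_divisors (mem_filter.mp hq).1).ne'
  have hRc : ∑ q ∈ (primesProdBelow z).divisors.filter (fun q : ℕ => (q : ℝ) ≤ D),
      |(seqClass X η d a b).remainder q (classTop X η d a b)| =
      ∑ q ∈ (primesProdBelow z).divisors.filter (fun q : ℕ => (q : ℝ) ≤ D),
        |(residueClassDivCount X η d a b q : ℝ) - typeIMainTerm X η d q| :=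
    sum_congr rfl fun q hq => by rw [remainder_seqClass_eq X η d a b (hq0 q hq)]
  have hRp : ∑ q ∈ (primesProdBelow z).divisors.filter (fun q : ℕ => (q : ℝ) ≤ D),
      |(seqClass ((d : ℝ) * X) η 1 a b).remainder q (classTop ((d : ℝ) * X) η 1 a b)| =
      ∑ q ∈ (primesProdBelow z).divisors.filter (fun q : ℕ => (q : ℝ) ≤ D),
        |(residueClassDivCount ((d : ℝ) * X) η 1 a b q : ℝ) - typeIMainTerm ((d : ℝ) * X) η 1 q| :=
    sum_congr rfl fun q hq => by rw [remainder_seqClass_eq ((d : ℝ) * X) η 1 a b (hq0 q hq)]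
  -- sizes and density products
  have hMc : (seqClass X η d a b).size (classTop X η d a b) = typeIMainTerm X η d 1 := rfl
  have hMp : (seqClass ((d : ℝ) * X) η 1 a b).size (classTop ((d : ℝ) * X) η 1 a b) =
      typeIMainTerm ((d : ℝ) * X) η 1 1 := rfl
  have hVc : (seqClass X η d a b).densityProduct (primesProdBelow z) =
      coprimeClassWeight d * prodA z := by
    rw [densityProduct_seqClass_eq, classEnhancementBelow_eq_of_lt hd.ne' hpz]
  have hcW1 : coprimeClassWeight 1 = 1 := by simp [coprimeClassWeight]
  have hVp : (seqClass ((d : ℝ) * X) η 1 a b).densityProduct (primesProdBelow z) = prodA z := by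
    rw [densityProduct_seqClass_eq, classEnhancementBelow_eq_of_lt one_ne_zero
      (fun p hp h1 => absurd h1 hp.not_dvd_one), hcW1, one_mul]
  rw [hRc, hMc, hVc] at hcls
  rw [hRp, hMp, hVp] at hpar
  -- the dictionary: the two main terms are proportional, EXACTLY
  have hmain : typeIMainTerm X η d 1 * (coprimeClassWeight d * prodA z) =
      classWeight d / (d : ℝ) ^ 2 * (typeIMainTerm ((d : ℝ) * X) η 1 1 * prodA z) := by
    rw [typeIMainTerm_class_eq hd.ne' (Nat.coprime_one_left d) X η]
    have hw : coprimeClassWeight d ≠ 0 := (coprimeClassWeight_pos d).ne'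
    field_simp
  set Sc := (seqClass X η d a b).sifted (classTop X η d a b) (primesProdBelow z)
  set Sp := (seqClass ((d : ℝ) * X) η 1 a b).sifted (classTop ((d : ℝ) * X) η 1 a b)
    (primesProdBelow z)
  set Rc := ∑ q ∈ (primesProdBelow z).divisors.filter (fun q : ℕ => (q : ℝ) ≤ D),
    |(residueClassDivCount X η d a b q : ℝ) - typeIMainTerm X η d q|
  set Rp := ∑ q ∈ (primesProdBelow z).divisors.filter (fun q : ℕ => (q : ℝ) ≤ D),
    |(residueClassDivCount ((d : ℝ) * X) η 1 a b q : ℝ) - typeIMainTerm ((d : ℝ) * X) η 1 q|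
  set E := Real.exp (-(Real.log D / Real.log z))
  set Mp := typeIMainTerm ((d : ℝ) * X) η 1 1 * prodA z with hMp'
  set lam := classWeight d / (d : ℝ) ^ 2
  set T := typeIMainTerm X η d 1 * (coprimeClassWeight d * prodA z) with hT
  have hlam : 0 ≤ lam := div_nonneg (classWeight_pos d).le (sq_nonneg _)
  have h1 : |Sc - T| ≤ C * T * E + Rc := by
    have e : C * T * E = C * typeIMainTerm X η d 1 * (coprimeClassWeight d * prodA z) * E := by
      rw [hT]; ring
    rw [e]; exact hcls
  have h2 : |Sp - Mp| ≤ C * Mp * E + Rp := by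
    have e : C * Mp * E = C * typeIMainTerm ((d : ℝ) * X) η 1 1 * prodA z * E := by
      rw [hMp']; ring
    rw [e]; exact hpar
  have h3 : |Sc - lam * Sp| ≤ |Sc - T| + lam * |Sp - Mp| := by
    calc |Sc - lam * Sp| = |(Sc - T) - lam * (Sp - Mp)| := by rw [hmain]; ring_nf
      _ ≤ |Sc - T| + |lam * (Sp - Mp)| := abs_sub _ _
      _ = |Sc - T| + lam * |Sp - Mp| := by rw [abs_mul, abs_of_nonneg hlam]
  have h4 : lam * |Sp - Mp| ≤ lam * (C * Mp * E + Rp) := mul_le_mul_of_nonneg_left h2 hlam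
  calc |Sc - lam * Sp| ≤ |Sc - T| + lam * |Sp - Mp| := h3
    _ ≤ (C * T * E + Rc) + lam * (C * Mp * E + Rp) := add_le_add h1 h4
    _ = lam * Mp * (2 * C * E) + Rc + lam * Rp := by rw [hmain]; ring

/-! ### (EQ) + (PAR) ⇒ the crux, by name -/

/-- **(EQ) Equidistribution over admissible classes** — the load-bearing statement of the line: the
class count minus `w(d)/d²` times the PARENT count — Heath-Brown's OWN `primePairCount` at scale `dX`
with the SAME `η = (log X)^{-c}` (the class box, minus `O(ηX)` boundary pairs, is the sub-finset
`x ≡ a, y ≡ b (mod d)` of `boxPairs (dX) η`, so every tree lemma stated for `boxPairs` applies to the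
parent verbatim) — is `o(η²X²/log X)` for every large box exponent.  No `σ₀`, no `κ`, no `ℬ`. -/
def ClassEquidistribution : Prop :=
  ∀ d a b : ℕ, 0 < d → Nat.Coprime (a ^ 3 + 2 * b ^ 3) d →
    ∃ c₁ : ℝ, 0 < c₁ ∧ ∀ c : ℝ, c₁ ≤ c →
      (fun X : ℝ => (residueClassPrimeCount X (Real.log X ^ (-c)) d a b : ℝ) -
          classWeight d / (d : ℝ) ^ 2 * (primePairCount ((d : ℝ) * X) (Real.log X ^ (-c)) : ℝ))
        =o[atTop] fun X : ℝ => (Real.log X ^ (-c)) ^ 2 * X ^ 2 / Real.log X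

/-- **(PAR) The parent asymptotic** — a pure `d = 1` statement: Heath-Brown's theorem at scale `dX` read
with `η = (log X)^{-c} = (log(X′/d))^{-c}`, `X′ = dX` (NOT `(log X′)^{-c}`): from the tree's
`HeathBrown2001_primePairCount_isLittleO_allLargeC` through the `η`-uniform (2.4)/(2.2)
(`HeathBrown2001_sieveComparison_at` is built on `η`-uniform Lemmas 3.4–3.10), or by a thin-slab
Brun–Titchmarsh squeeze — bookkeeping shared with every line (cf. cards `all-large-c-transfer`,
`upset-exponent-bookkeeping`). -/
def ParentAsymptotic : Prop :=
  ∃ c₀ : ℝ, 0 < c₀ ∧ ∃ σ₀ : ℝ, 0 < σ₀ ∧ Tendsto singularProductPartial atTop (𝓝 σ₀) ∧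
    ∀ d : ℕ, 0 < d → ∀ c : ℝ, c₀ ≤ c →
      (fun X : ℝ => (primePairCount ((d : ℝ) * X) (Real.log X ^ (-c)) : ℝ) -
          (d : ℝ) ^ 2 * mainTerm c σ₀ X) =o[atTop] fun X : ℝ => mainTerm c σ₀ X

/-- `η²X²/log X = (3/σ₀)·mainTerm`. -/
theorem scale_eq_const_mul_mainTerm {σ₀ : ℝ} (hσ₀ : σ₀ ≠ 0) (c : ℝ) :
    (fun X : ℝ => (Real.log X ^ (-c)) ^ 2 * X ^ 2 / Real.log X) =
      fun X : ℝ => 3 / σ₀ * mainTerm c σ₀ X := by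
  funext X
  rw [mainTerm_def]
  by_cases hL : Real.log X = 0
  · simp [hL]
  · field_simp

/-- **The line concludes the crux BY NAME**: (EQ) + (PAR) ⇒ `HeathBrownMorozUniform`, through the tree's
`heathBrownMorozUniform_of_allLargeC` (p536103). -/
theorem heathBrownMorozUniform_of_equidistribution (hEQ : ClassEquidistribution)
    (hPAR : ParentAsymptotic) :
    Summit.Parity.GeneralizedHardyLittlewood.Theses.GoldbachHeathBrownDispersion.HeathBrownMorozUniform := by
  obtain ⟨c₀, hc₀, σ₀, hσ₀, hlim, hpar⟩ := hPAR
  refine heathBrownMorozUniform_of_allLargeC fun d a b hd _ _ hab => ?_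
  obtain ⟨c₁, hc₁, heq⟩ := hEQ d a b hd hab
  refine ⟨max c₁ c₀, lt_max_of_lt_left hc₁, fun c hc => ⟨σ₀, hσ₀, hlim, ?_⟩⟩
  have h1 := heq c ((le_max_left _ _).trans hc)
  have h2 := hpar d hd c ((le_max_right _ _).trans hc)
  have hd' : (d : ℝ) ≠ 0 := Nat.cast_ne_zero.2 hd.ne'
  have hbig : (fun X : ℝ => (Real.log X ^ (-c)) ^ 2 * X ^ 2 / Real.log X) =O[atTop]
      fun X : ℝ => mainTerm c σ₀ X := by
    rw [scale_eq_const_mul_mainTerm hσ₀.ne' c]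
    exact isBigO_const_mul_self _ _ _
  have h1' := h1.trans_isBigO hbig
  have h2' := h2.const_mul_left (classWeight d / (d : ℝ) ^ 2)
  refine (h1'.add h2').congr_left fun X => ?_
  field_simp
  ring

end Summit.Parity.GeneralizedHardyLittlewood.Cruxes.HeathBrownMorozUniform.ParentDifferencing

end
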